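import Summits.AtomisticToContinuum.HydrodynamicLimit.Theses.TwoClocks
import Summits.AtomisticToContinuum.HydrodynamicLimit.Theorems.AntiMazurCoboundariesKineticWindowGronwallFamilyGlueCompare
import Summits.AtomisticToContinuum.HydrodynamicLimit.Theorems.AntiMazurCoboundariesKineticWindowGronwallLadderAssembly
import HarnessLib

/-!
# Family glue, file 2 of 3: statements of the v7 nodes and slab tools (toward stub `stub_familyGlue`,
# line `rare-band-ladder-dock` v7, crux `KineticWindowGronwall`, stmt-AtomisticToContinuum-9282)

Crux `Summit.AtomisticToContinuum.HydrodynamicLimit.Theses.AntiMazurCoboundaries.KineticWindowGronwall`. This file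
re-declares VERBATIM the statements of the registered skeleton `Cruxes/KineticWindowGronwall/Lines/rare_band_ladder_dock.lean`
(v7) that the glue theorem (file 3, `…KineticWindowGronwallFamilyGlue.lean`) mentions — the family node
`LocalQuadraticWindowLDFamily`, the profile-wise wall node `LocalQuadraticWindowLDBounds`, `FamilyGlue`, and the three
helper statements `TwoProfileTransfer`, `WindowEnergyMoment`, `TailReorth` (registered stubs of the line, the last two
LANDED: `Theorems.KineticWindowGronwallWindowEnergyMoment.stub_windowEnergyMoment`,
`Theorems.KineticWindowGronwallTailReorth.stub_tailReorth`; same terms) — and proves the small tools of the glue: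
orthogonality under scalars, extrema and UNIFORM MODULI of jointly continuous data on the compact slab `[0,t₁] × 𝕋³`
(registered helper stub `stub_familyGlueSlabModulus`), continuity of thermal-frame product observables, and
`σ ≤ 1/2` from the packing guard.
-/

noncomputable section

namespace Summit.AtomisticToContinuum.HydrodynamicLimit.Theorems.KineticWindowGronwallFamilyGlue

open MeasureTheory Set Filter Metric
open scoped ENNReal BigOperators
open Literature.Analysis.FluidPDE Literature.MathematicalPhysics.KineticTheory

/-! ## §1 Statements (verbatim from the registered skeleton v7) -/

/-- The hard-sphere flow of `N+1` spheres at reduced density `σ` on `𝕋³`. -/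
abbrev TFlow (σ : ℝ) (N : ℕ) : Type :=
  HardSphereFlow (Torus.geometry (Fin 3)) (hsDiameter σ N) (N + 1)

/-- The orthogonality clause of all kinetic statements of this line (verbatim the clause of `KineticFluxLdDecay`):
`g ⊥ span{1, w, ‖w‖²}` in `L²(stdGaussian)` — the thermal-frame collision invariants. -/
def Orth (g : V3 → ℝ) : Prop :=
  ∀ (c₀ c₂ : ℝ) (b : V3), ∫ v, g v * (c₀ + inner ℝ b v + c₂ * ‖v‖ ^ 2) ∂(ProbabilityTheory.stdGaussian V3) = 0

/-- **The docking node of the line** (verbatim from the skeleton): local quadratic-class window LD in product form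
along jointly continuous families, thresholds uniform in `s ∈ [0,t₁]`. -/
def LocalQuadraticWindowLDFamily : Prop :=
  ∃ η₀ : ℝ, 0 < η₀ ∧ ∀ (t₁ : ℝ) (a θ₀ : ℝ → T3 → ℝ) (u₀ : ℝ → T3 → V3),
    Continuous (Function.uncurry a) → Continuous (Function.uncurry θ₀) → Continuous (Function.uncurry u₀) →
    (∀ s x, 0 < a s x) → (∀ s x, 0 < θ₀ s x) →
    ∀ σ : ℝ, 0 < σ → (∀ s ∈ Set.Icc 0 t₁, σ ^ 3 * (⨆ x, a s x) ≤ η₀ * ∫ x, a s x) →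
    ∃ cstar : ℝ, 0 < cstar ∧
    ∀ Φ : (N : ℕ) → TFlow σ N,
    ∀ (φ : ℝ → T3 → ℝ) (g : V3 → ℝ), Continuous (Function.uncurry φ) → Continuous g →
      (∀ s x, |φ s x| ≤ 1) → (∀ w, |g w| ≤ cstar * (1 + ‖w‖ ^ 2)) → Orth g →
      ∀ ε : ℝ, 0 < ε → ∃ τ₀ : ℝ, 0 < τ₀ ∧ ∀ τ : ℝ, τ₀ ≤ τ → ∃ N₀ : ℕ, ∀ N : ℕ, N₀ ≤ N →
      ∀ s ∈ Set.Icc 0 t₁,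
        ∫⁻ z, ENNReal.ofReal (Real.exp (∑ i : Fin (N + 1),
            (τ * ((N : ℝ) + 1) ^ (-(1 / 3 : ℝ)))⁻¹ *
              ∫ r in (0 : ℝ)..(τ * ((N : ℝ) + 1) ^ (-(1 / 3 : ℝ))),
                φ s ((Φ N).flow r z i).1 *
                  g ((Real.sqrt (θ₀ s ((Φ N).flow r z i).1))⁻¹ •
                    (((Φ N).flow r z i).2 - u₀ s ((Φ N).flow r z i).1))))
          ∂(localGibbsLaw σ (a s) (u₀ s) (θ₀ s) N (Φ N)) ≤
        ENNReal.ofReal (Real.exp (ε * ((N : ℝ) + 1)))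

/-- **The wall node, profile-wise** (verbatim from the skeleton v7): amplitude uniform over bounded profile classes,
thresholds pointwise, all windows. -/
def LocalQuadraticWindowLDBounds : Prop :=
  ∃ η₀ : ℝ, 0 < η₀ ∧ ∀ (θm θM U : ℝ), 0 < θm → θm ≤ θM → 0 ≤ U → ∀ σ : ℝ, 0 < σ →
    ∃ cstar : ℝ, 0 < cstar ∧
    ∀ (a θ₀ : T3 → ℝ) (u₀ : T3 → V3), Continuous a → Continuous θ₀ → Continuous u₀ →
    (∀ x, 0 < a x) → (∀ x, θm ≤ θ₀ x) → (∀ x, θ₀ x ≤ θM) → (∀ x, ‖u₀ x‖ ≤ U) →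
    σ ^ 3 * (⨆ x, a x) ≤ η₀ * ∫ x, a x →
    ∀ Φ : (N : ℕ) → TFlow σ N,
    ∀ (φ : T3 → ℝ) (g : V3 → ℝ), Continuous φ → Continuous g →
      (∀ x, |φ x| ≤ 1) → (∀ w, |g w| ≤ cstar * (1 + ‖w‖ ^ 2)) → Orth g →
      ∀ ε : ℝ, 0 < ε → ∃ τ₀ : ℝ, 0 < τ₀ ∧ ∀ τ : ℝ, τ₀ ≤ τ → ∃ N₀ : ℕ, ∀ N : ℕ, N₀ ≤ N →
        ∫⁻ z, ENNReal.ofReal (Real.exp (∑ i : Fin (N + 1),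
            (τ * ((N : ℝ) + 1) ^ (-(1 / 3 : ℝ)))⁻¹ *
              ∫ r in (0 : ℝ)..(τ * ((N : ℝ) + 1) ^ (-(1 / 3 : ℝ))),
                φ ((Φ N).flow r z i).1 *
                  g ((Real.sqrt (θ₀ ((Φ N).flow r z i).1))⁻¹ •
                    (((Φ N).flow r z i).2 - u₀ ((Φ N).flow r z i).1))))
          ∂(localGibbsLaw σ a u₀ θ₀ N (Φ N)) ≤
        ENNReal.ofReal (Real.exp (ε * ((N : ℝ) + 1)))

/-- **The family glue** (verbatim from the skeleton v7; signature of the registered stub `stub_familyGlue`). -/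
def FamilyGlue : Prop :=
  LocalQuadraticWindowLDBounds → LocalQuadraticWindowLDFamily

/-- **Helper statement `TwoProfileTransfer`** (verbatim from the skeleton v7; neighbouring registered stub): static
order-2 Rényi change of measure between local Gibbs laws with nearby profiles. -/
def TwoProfileTransfer : Prop :=
  ∀ (θm θM : ℝ), 0 < θm → θm ≤ θM → ∀ δ : ℝ, 0 < δ → ∃ ρ : ℝ, 0 < ρ ∧
    ∀ (a₁ a₂ θ₁ θ₂ : T3 → ℝ) (u₁ u₂ : T3 → V3),
    Continuous a₁ → Continuous a₂ → Continuous θ₁ → Continuous θ₂ → Continuous u₁ → Continuous u₂ →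
    (∀ x, 0 < a₁ x) → (∀ x, 0 < a₂ x) →
    (∀ x, θm ≤ θ₁ x) → (∀ x, θ₁ x ≤ θM) → (∀ x, θm ≤ θ₂ x) → (∀ x, θ₂ x ≤ θM) →
    (∀ x, |Real.log (a₁ x) - Real.log (a₂ x)| ≤ ρ) → (∀ x, |θ₁ x - θ₂ x| ≤ ρ) → (∀ x, ‖u₁ x - u₂ x‖ ≤ ρ) →
    ∀ σ : ℝ, 0 < σ → σ ≤ 1 / 2 → ∀ (N : ℕ) (Φ : TFlow σ N) (G : Config (N + 1) (Fin 3) T3 → ℝ≥0∞), Measurable G →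
      ∫⁻ z, G z ∂(localGibbsLaw σ a₁ u₁ θ₁ N Φ) ≤
        ENNReal.ofReal (Real.exp (δ * ((N : ℝ) + 1))) *
          (∫⁻ z, G z ^ (2 : ℝ) ∂(localGibbsLaw σ a₂ u₂ θ₂ N Φ)) ^ (1 / 2 : ℝ)

/-- **Helper statement `WindowEnergyMoment`** (verbatim from the skeleton v7; neighbouring registered stub): the window
exponential moment of `λΣᵢ(1 + ‖vᵢ‖²)` under a local Gibbs law (energy conservation + fibre Gaussians). -/
def WindowEnergyMoment : Prop :=
  ∀ (θM U : ℝ), 0 < θM → 0 ≤ U → ∃ lam₀ : ℝ, 0 < lam₀ ∧ ∃ C : ℝ, 0 < C ∧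
    ∀ (a θ₀ : T3 → ℝ) (u₀ : T3 → V3), Continuous a → Continuous θ₀ → Continuous u₀ →
    (∀ x, 0 < a x) → (∀ x, 0 < θ₀ x) → (∀ x, θ₀ x ≤ θM) → (∀ x, ‖u₀ x‖ ≤ U) →
    ∀ σ : ℝ, 0 < σ → σ ≤ 1 / 2 → ∀ (N : ℕ) (Φ : TFlow σ N) (lam : ℝ), 0 ≤ lam → lam ≤ lam₀ →
    ∀ w : ℝ, 0 < w →
      ∫⁻ z, ENNReal.ofReal (Real.exp (∑ i : Fin (N + 1),
          w⁻¹ * ∫ r in (0 : ℝ)..w, lam * (1 + ‖(Φ.flow r z i).2‖ ^ 2))) ∂(localGibbsLaw σ a u₀ θ₀ N Φ) ≤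
        ENNReal.ofReal (Real.exp (C * lam * ((N : ℝ) + 1)))

/-- **Helper statement `TailReorth`** (verbatim from the skeleton v7; neighbouring registered stub): the
re-orthogonalised radial tail cut-off. -/
def TailReorth : Prop :=
  ∀ η : ℝ, 0 < η → ∀ R₀ : ℝ, ∃ R : ℝ, R₀ ≤ R ∧ 1 ≤ R ∧ ∃ (t : V3 → ℝ) (α γ : ℝ),
    Continuous t ∧ |α| ≤ η ∧ |γ| ≤ η ∧
    (∀ w, 0 ≤ t w) ∧ (∀ w, t w ≤ 1 + ‖w‖ ^ 2) ∧ (∀ w, R ≤ ‖w‖ → t w = 1 + ‖w‖ ^ 2) ∧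
    (∀ w, ‖w‖ ≤ R - 1 → t w = 0) ∧
    Orth (fun w => t w - (α + γ * ‖w‖ ^ 2))

/-! ## §2 Small tools: orthogonality algebra, slab bounds and slab moduli, continuity of product observables -/

/-- **Slab extrema**: a jointly continuous real function on `ℝ × 𝕋³` attains a minimum and a maximum on the compact slab
`[0,t₁] × 𝕋³` (`0 ≤ t₁`). [folklore] -/
theorem exists_slab_bounds {F : ℝ → T3 → ℝ} (hF : Continuous (Function.uncurry F)) {t₁ : ℝ} (ht₁ : 0 ≤ t₁) :
    ∃ m M : ℝ, (∃ s ∈ Icc (0 : ℝ) t₁, ∃ x, F s x = m) ∧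
      (∀ s ∈ Icc (0 : ℝ) t₁, ∀ x, m ≤ F s x) ∧ (∀ s ∈ Icc (0 : ℝ) t₁, ∀ x, F s x ≤ M) := by
  have hK : IsCompact (Icc (0 : ℝ) t₁ ×ˢ (univ : Set T3)) := isCompact_Icc.prod isCompact_univ
  have hne : (Icc (0 : ℝ) t₁ ×ˢ (univ : Set T3)).Nonempty := ⟨(0, 0), ⟨⟨le_rfl, ht₁⟩, mem_univ _⟩⟩
  obtain ⟨p, hp, hpmin⟩ := hK.exists_isMinOn hne hF.continuousOn
  obtain ⟨q, hq, hqmax⟩ := hK.exists_isMaxOn hne hF.continuousOn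
  refine ⟨F p.1 p.2, F q.1 q.2, ⟨p.1, hp.1, p.2, rfl⟩, fun s hs x => ?_, fun s hs x => ?_⟩
  · exact (isMinOn_iff.1 hpmin) (s, x) ⟨hs, mem_univ _⟩
  · exact (isMaxOn_iff.1 hqmax) (s, x) ⟨hs, mem_univ _⟩

/-- **Slab modulus**: a jointly continuous map on `ℝ × 𝕋³` into a pseudo-metric space is uniformly continuous in `s`
on the slab `[0,t₁] × 𝕋³`, uniformly in `x`. [folklore] -/
theorem exists_slab_modulus {M : Type*} [PseudoMetricSpace M] {F : ℝ → T3 → M}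
    (hF : Continuous (Function.uncurry F)) (t₁ : ℝ) {tol : ℝ} (htol : 0 < tol) :
    ∃ δ : ℝ, 0 < δ ∧ ∀ s ∈ Icc (0 : ℝ) t₁, ∀ s' ∈ Icc (0 : ℝ) t₁, |s - s'| ≤ δ →
      ∀ x, dist (F s x) (F s' x) ≤ tol := by
  have hK : IsCompact (Icc (0 : ℝ) t₁ ×ˢ (univ : Set T3)) := isCompact_Icc.prod isCompact_univ
  have hU := hK.uniformContinuousOn_of_continuous hF.continuousOn
  rw [Metric.uniformContinuousOn_iff] at hU
  obtain ⟨δ, hδ, H⟩ := hU tol htol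
  refine ⟨δ / 2, by positivity, fun s hs s' hs' hss x => ?_⟩
  have hd : dist ((s, x) : ℝ × T3) (s', x) < δ := by
    rw [Prod.dist_eq, dist_self, max_eq_left dist_nonneg, Real.dist_eq]
    linarith
  exact (H (s, x) ⟨hs, mem_univ _⟩ (s', x) ⟨hs', mem_univ _⟩ hd).le

/-- **Continuity of the product observable** `y ↦ φ(y₁) · g((v − u(y₁))/√θ(y₁))` for continuous `φ, g, u` and
continuous positive `θ`. [folklore] -/
theorem continuous_productObs {φ θ : T3 → ℝ} {u : T3 → V3} {g : V3 → ℝ} (hφ : Continuous φ) (hθ : Continuous θ)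
    (hθ0 : ∀ x, 0 < θ x) (hu : Continuous u) (hg : Continuous g) :
    Continuous fun y : T3 × V3 => φ y.1 * g ((Real.sqrt (θ y.1))⁻¹ • (y.2 - u y.1)) := by
  have h1 : Continuous fun y : T3 × V3 => (Real.sqrt (θ y.1))⁻¹ :=
    ((Real.continuous_sqrt.comp (hθ.comp continuous_fst)).inv₀ fun y =>
      (Real.sqrt_pos.2 (hθ0 y.1)).ne')
  have h2 : Continuous fun y : T3 × V3 => y.2 - u y.1 := continuous_snd.sub (hu.comp continuous_fst)
  exact (hφ.comp continuous_fst).mul (hg.comp (h1.smul h2))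

/-- The guard `σ³·sup a ≤ η ∫a` with `η ≤ 1/16` forces `σ ≤ 1/2` (continuous positive activity on `𝕋³`; the torus has
unit volume so `∫a ≤ sup a`). [folklore] -/
theorem sigma_le_half_of_guard {a : T3 → ℝ} (ha : Continuous a) (ha0 : ∀ x, 0 < a x) {σ η : ℝ}
    (hη : η ≤ 1 / 16) (hguard : σ ^ 3 * (⨆ x, a x) ≤ η * ∫ x, a x) : σ ≤ 1 / 2 := by
  have hbdd : BddAbove (Set.range a) := (isCompact_range ha).bddAbove
  have hsup_ge : ∀ x, a x ≤ ⨆ y, a y := fun x => le_ciSup hbdd x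
  have hsup_pos : 0 < ⨆ y, a y := (ha0 0).trans_le (hsup_ge 0)
  have hint_le : ∫ y, a y ≤ ⨆ y, a y :=
    (integral_mono (integrable_of_continuous_T3 ha) (integrable_const _) hsup_ge).trans (by simp)
  have hint_pos : 0 < ∫ y, a y := integral_pos_of_continuous_pos ha ha0
  have hσ3 : σ ^ 3 ≤ 1 / 16 := by
    have h1 : σ ^ 3 * (⨆ y, a y) ≤ (1 / 16) * (⨆ y, a y) := by
      refine hguard.trans ?_
      rcases le_or_gt 0 η with hη0 | hη0
      · exact (mul_le_mul_of_nonneg_left hint_le hη0).trans (mul_le_mul_of_nonneg_right hη hsup_pos.le)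
      · have : η * ∫ y, a y < 0 := mul_neg_of_neg_of_pos hη0 hint_pos
        have : (0 : ℝ) ≤ 1 / 16 * ⨆ y, a y := by positivity
        linarith
    exact le_of_mul_le_mul_right h1 hsup_pos
  by_contra hc
  push Not at hc
  have : (1 / 2 : ℝ) ^ 3 < σ ^ 3 := pow_lt_pow_left₀ hc (by norm_num) (by norm_num)
  nlinarith

/-! ## §3 The registered helper statement of this file -/

/-- Helper statement `FamilyGlueSlabModulus` (helper stub `stub_familyGlueSlabModulus` of `stub_familyGlue`, line
rare-band-ladder-dock v7, file 2 of 3): a jointly continuous real datum on `ℝ × 𝕋³` has a modulus of continuity in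
`s` on the slab `[0,t₁] × 𝕋³` that is UNIFORM in `x` — route-internal, not a cited fact. -/
def FamilyGlueSlabModulus : Prop :=
  ∀ (F : ℝ → T3 → ℝ), Continuous (Function.uncurry F) → ∀ (t₁ tol : ℝ), 0 < tol →
    ∃ δ : ℝ, 0 < δ ∧ ∀ s ∈ Set.Icc (0 : ℝ) t₁, ∀ s' ∈ Set.Icc (0 : ℝ) t₁, |s - s'| ≤ δ →
      ∀ x, |F s x - F s' x| ≤ tol

/-- **Registered helper stub `stub_familyGlueSlabModulus`** (helper of `stub_familyGlue`, file 2 of 3):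
`FamilyGlueSlabModulus` holds (`exists_slab_modulus` on the compact slab). [folklore] -/
theorem stub_familyGlueSlabModulus : FamilyGlueSlabModulus := by
  intro F hF t₁ tol htol
  obtain ⟨δ, hδ, H⟩ := exists_slab_modulus hF t₁ htol
  refine ⟨δ, hδ, fun s hs s' hs' hss x => ?_⟩
  have := H s hs s' hs' hss x
  rwa [Real.dist_eq] at this

end Summit.AtomisticToContinuum.HydrodynamicLimit.Theorems.KineticWindowGronwallFamilyGlue

end
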